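import Summits.QuantumFields.YangMills.Theorems.ColdStartUniversalityLatticeLangevinDossSussmannBackwardKolmogorov
import HarnessLib

/-!
# Route `ColdStartUniversality` (fixed-cut-off SZZ dynamics; Doss–Sussmann smoothing programme, file 17):
# GENERATOR-FORM POINCARÉ ⇒ EXPONENTIAL `L²(μ_{β'})` DECAY FOR `C³` CYLINDER OBSERVABLES — WITHOUT the smoothing hypothesis `(S)`

Helper file (seat `ym-line-csu-p1`, g24).  `…WilsonSemigroupPoincareSmoothing` (g17) derived the body of `hEquiv`,
`∫ (κ_t G − μG)² dμ_{β'} ≤ e^{−2λt} Var(G)`, from the generator-form Poincaré inequality on `C³` cylinders PLUS a smoothing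
hypothesis `(S)` (`κ_s C(X) ⊆ C³_c ∘ coords`, hypoelliptic, not in the tree).  With `P_t(C³_c) ⊂ C³_c` (files 13–15) and the
backward Kolmogorov / commutation identity (file 16) the classical Grönwall argument runs on the cylinder algebra itself:
* `le_exp_mul_of_hasDerivAt_le` — Grönwall: `w' ≤ −c w` on `(0,∞)`, `w` continuous on `[0,∞)` ⇒ `w(t) ≤ e^{−ct} w(0)`;
* ★★★ `integral_sq_transition_sub_le_exp_of_generatorPoincare_cylinder` — for ANY realising kernel family `κ`, if
  `λ Var_μ(F) ≤ −∫ (F − μF) 𝓛f dμ` for all `C³` `f` (`F = f∘coords`; verbatim the hypothesis `hPgen` of g17), then for every `C³`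
  compactly supported `f`: `∫ (κ_t F − μF)² dμ_{β'} ≤ e^{−2λt} Var_μ(F)` — `w(t) = Var(κ_t F)` has
  `w'(t) = 2∫(κ_tF − μF)·𝓛(κ_tF) dμ ≤ −2λ w(t)` (`κ_t F = g_t∘coords ∈ C³_c`, `∂_t κ_tF = κ_t𝓛F = 𝓛κ_tF`, invariance of `μ_{β'}`).
The extension to all continuous `G` (density of cylinders in `C(SU(2)^E)`) is NOT done here.
THEOREMS ONLY, no sorry.  HONEST FRAMING: fixed-cut-off `L²` calculus; the Poincaré inequality is a HYPOTHESIS; nothing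
K-uniform; no crux, rung or summit statement is proved; the Yang–Mills mass gap is NOT proved.
-/

set_option autoImplicit false

noncomputable section

namespace Summit.QuantumFields.YangMills.Theorems.ColdStartUniversality

open MeasureTheory ProbabilityTheory Finset Filter Set
open scoped BigOperators NNReal ENNReal Topology
open Literature.Probability.Process Literature.MathematicalPhysics.QuantumFieldTheory
open Literature.MathematicalPhysics.QuantumLattice (fundamentalRep fundamentalLatticeRep continuous_fundamentalRep)

/-- **Grönwall's inequality, one-sided linear form.**  If `w` is continuous on `[0,∞)`, differentiable on `(0,∞)` with
`w' ≤ −c·w` there, then `w(t) ≤ e^{−ct} w(0)` for `t ≥ 0`. [folklore] -/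
theorem le_exp_mul_of_hasDerivAt_le {w w' : ℝ → ℝ} {c : ℝ} (hc : ContinuousOn w (Ici 0))
    (hd : ∀ τ, 0 < τ → HasDerivAt w (w' τ) τ) (hle : ∀ τ, 0 < τ → w' τ ≤ -c * w τ) {t : ℝ} (ht : 0 ≤ t) :
    w t ≤ Real.exp (-c * t) * w 0 := by
  have hφc : ContinuousOn (fun τ => Real.exp (c * τ) * w τ) (Ici 0) :=
    (Real.continuous_exp.comp (continuous_const.mul continuous_id)).continuousOn.mul hc
  have hφd : ∀ τ, 0 < τ → HasDerivAt (fun τ => Real.exp (c * τ) * w τ)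
      (Real.exp (c * τ) * (c * 1) * w τ + Real.exp (c * τ) * w' τ) τ := fun τ hτ =>
    (((hasDerivAt_id τ).const_mul c).exp).mul (hd τ hτ)
  have hanti : AntitoneOn (fun τ => Real.exp (c * τ) * w τ) (Ici 0) := by
    refine antitoneOn_of_deriv_nonpos (convex_Ici 0) hφc (fun τ hτ => ?_) (fun τ hτ => ?_)
    · rw [interior_Ici] at hτ
      exact (hφd τ hτ).differentiableAt.differentiableWithinAt
    · rw [interior_Ici] at hτ
      rw [(hφd τ hτ).deriv]
      have h := hle τ hτ
      have hexp : 0 < Real.exp (c * τ) := Real.exp_pos _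
      nlinarith
  have h0 := hanti (self_mem_Ici) (show t ∈ Ici (0 : ℝ) from ht) ht
  simp only [mul_zero, Real.exp_zero, one_mul] at h0
  have hexp : Real.exp (-c * t) * Real.exp (c * t) = 1 := by rw [← Real.exp_add]; simp
  calc w t = Real.exp (-c * t) * (Real.exp (c * t) * w t) := by rw [← mul_assoc, hexp, one_mul]
    _ ≤ Real.exp (-c * t) * w 0 := mul_le_mul_of_nonneg_left h0 (Real.exp_pos _).le

variable {L : ℕ} [NeZero L]

/-- ★★★ **Generator-form Poincaré ⇒ exponential `L²(μ_{β'})` decay along the semigroup, for `C³` cylinder observables**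
(no smoothing hypothesis).  For any realising Markov kernel family `κ` of the SU(2) SZZ dynamics at coupling `β'`: if
`λ Var_μ(f∘coords) ≤ −∫ (f∘coords − μ(f∘coords))·𝓛f dμ_{β'}` for every `C³` `f`, then for every `C³` compactly supported `f` and
every `t`, `∫ (κ_t(f∘coords) − μ(f∘coords))² dμ_{β'} ≤ e^{−2λt} Var_μ(f∘coords)`. [cite: BakryGentilLedoux2014, Thm 4.2.5] -/
theorem integral_sq_transition_sub_le_exp_of_generatorPoincare_cylinder (L : ℕ) [NeZero L] (β' : ℝ)
    (κ : ℝ≥0 → Kernel (GaugeConfig 3 L (Matrix.specialUnitaryGroup (Fin 2) ℂ))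
      (GaugeConfig 3 L (Matrix.specialUnitaryGroup (Fin 2) ℂ))) [∀ t, IsMarkovKernel (κ t)]
    (hreal : ∀ (t : ℝ≥0) (x : GaugeConfig 3 L (Matrix.specialUnitaryGroup (Fin 2) ℂ))
        (Ω : Type) [MeasurableSpace Ω] (P : Measure Ω) [IsProbabilityMeasure P]
        (W : ℝ≥0 → Ω → (Edge 3 L × NoiseIdx 2 → ℝ)) (hW : IsFlatBrownian W P)
        (U : ℝ≥0 → Ω → GaugeConfig 3 L (Matrix.specialUnitaryGroup (Fin 2) ℂ)),
        (∀ ω, U 0 ω = x) →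
        (latticeLangevinDynamics (fundamentalLatticeRep 2) β').IsSolution (fundamentalRep (Fin 2))
          hW.natFiltration P W U →
        κ t x = P.map (U t))
    {lam : ℝ}
    (hPgen : ∀ (f : (Edge 3 L × Fin 2 × Fin 2 × Bool → ℝ) → ℝ), ContDiff ℝ 3 f →
        let coords : GaugeConfig 3 L (Matrix.specialUnitaryGroup (Fin 2) ℂ) → (Edge 3 L × Fin 2 × Fin 2 × Bool → ℝ) :=
          fun V q => (fun z : ℂ => if q.2.2.2 then z.im else z.re)
            ((fundamentalRep (Fin 2) (V q.1) : Matrix (Fin 2) (Fin 2) ℂ) q.2.1 q.2.2.1)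
        let gen : GaugeConfig 3 L (Matrix.specialUnitaryGroup (Fin 2) ℂ) → ℝ := fun V =>
          (∑ i : Edge 3 L × Fin 2 × Fin 2 × Bool, fderiv ℝ f (coords V) (Pi.single i 1) *
              (fun z : ℂ => if i.2.2.2 then z.im else z.re)
                ((latticeLangevinDynamics (fundamentalLatticeRep 2) β').drift
                  (matrixConfig (fundamentalRep (Fin 2)) V) i.1 i.2.1 i.2.2.1) +
          1 / 2 * ∑ i : Edge 3 L × Fin 2 × Fin 2 × Bool, ∑ j : Edge 3 L × Fin 2 × Fin 2 × Bool,
            fderiv ℝ (fun z => fderiv ℝ f z (Pi.single i 1)) (coords V) (Pi.single j 1) *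
              ∑ n : Edge 3 L × NoiseIdx 2,
                (if n.1 = i.1 then (fun z : ℂ => if i.2.2.2 then z.im else z.re)
                  ((latticeLangevinDynamics (fundamentalLatticeRep 2) β').noise
                    (matrixConfig (fundamentalRep (Fin 2)) V) i.1 n.2 i.2.1 i.2.2.1) else 0) *
                (if n.1 = j.1 then (fun z : ℂ => if j.2.2.2 then z.im else z.re)
                  ((latticeLangevinDynamics (fundamentalLatticeRep 2) β').noise
                    (matrixConfig (fundamentalRep (Fin 2)) V) j.1 n.2 j.2.1 j.2.2.1) else 0))
        lam * ∫ V, (f (coords V) - ∫ V', f (coords V') ∂(wilsonMeasure (d := 3) (L := L) (fundamentalRep (Fin 2)) β')) ^ 2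
            ∂(wilsonMeasure (d := 3) (L := L) (fundamentalRep (Fin 2)) β') ≤
          -∫ V, (f (coords V) - ∫ V', f (coords V') ∂(wilsonMeasure (d := 3) (L := L) (fundamentalRep (Fin 2)) β')) *
            gen V ∂(wilsonMeasure (d := 3) (L := L) (fundamentalRep (Fin 2)) β'))
    {f : (Edge 3 L × Fin 2 × Fin 2 × Bool → ℝ) → ℝ} (hf : ContDiff ℝ 3 f) (hfc : HasCompactSupport f) (t : ℝ≥0) :
    let coords : GaugeConfig 3 L (Matrix.specialUnitaryGroup (Fin 2) ℂ) → (Edge 3 L × Fin 2 × Fin 2 × Bool → ℝ) :=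
      fun V q => (fun z : ℂ => if q.2.2.2 then z.im else z.re)
        ((fundamentalRep (Fin 2) (V q.1) : Matrix (Fin 2) (Fin 2) ℂ) q.2.1 q.2.2.1)
    ∫ x, ((∫ y, f (coords y) ∂(κ t x)) - ∫ z, f (coords z) ∂(wilsonMeasure (d := 3) (L := L) (fundamentalRep (Fin 2)) β')) ^ 2
        ∂(wilsonMeasure (d := 3) (L := L) (fundamentalRep (Fin 2)) β') ≤
      Real.exp (-2 * lam * t) *
        ∫ x, (f (coords x) - ∫ z, f (coords z) ∂(wilsonMeasure (d := 3) (L := L) (fundamentalRep (Fin 2)) β')) ^ 2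
          ∂(wilsonMeasure (d := 3) (L := L) (fundamentalRep (Fin 2)) β') := by
  intro coords
  classical
  haveI := secondCountableTopology_su2
  haveI := borelSpace_config L
  set μ : Measure (GaugeConfig 3 L (Matrix.specialUnitaryGroup (Fin 2) ℂ)) :=
    wilsonMeasure (d := 3) (L := L) (fundamentalRep (Fin 2)) β' with hμ
  haveI : IsProbabilityMeasure μ :=
    isProbabilityMeasure_wilsonMeasure (d := 3) (L := L) (fundamentalRep (Fin 2)) (continuous_fundamentalRep (Fin 2)) β'
  have hco : Continuous coords := continuous_coords (L := L)
  have hFc : Continuous fun V => f (coords V) := hf.continuous.comp hco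
  obtain ⟨Mf, hMf⟩ : ∃ M, ∀ V, |f (coords V)| ≤ M := by
    obtain ⟨M, hM⟩ := isCompact_univ.exists_bound_of_continuousOn hFc.continuousOn
    exact ⟨M, fun V => by simpa [Real.norm_eq_abs] using hM V (Set.mem_univ V)⟩
  -- the smoothed observables `g_s`, the commutation identity and the time derivative (files 15–16)
  have hBK := fun s : ℝ≥0 => transitionKernel_backwardKolmogorov (L := L) β' κ hreal hf hfc s
  choose g hg hgc hgF hcomm _hder using hBK
  -- the generator of `f` (as a function on the group) is continuous and bounded
  obtain ⟨genf, hgenf⟩ : ∃ genf : GaugeConfig 3 L (Matrix.specialUnitaryGroup (Fin 2) ℂ) → ℝ, genf = fun V =>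
      (∑ i : Edge 3 L × Fin 2 × Fin 2 × Bool, fderiv ℝ f (coords V) (Pi.single i 1) *
          (fun z : ℂ => if i.2.2.2 then z.im else z.re)
            ((latticeLangevinDynamics (fundamentalLatticeRep 2) β').drift
              (matrixConfig (fundamentalRep (Fin 2)) V) i.1 i.2.1 i.2.2.1) +
      1 / 2 * ∑ i : Edge 3 L × Fin 2 × Fin 2 × Bool, ∑ j : Edge 3 L × Fin 2 × Fin 2 × Bool,
        fderiv ℝ (fun z => fderiv ℝ f z (Pi.single i 1)) (coords V) (Pi.single j 1) *
          ∑ n : Edge 3 L × NoiseIdx 2,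
            (if n.1 = i.1 then (fun z : ℂ => if i.2.2.2 then z.im else z.re)
              ((latticeLangevinDynamics (fundamentalLatticeRep 2) β').noise
                (matrixConfig (fundamentalRep (Fin 2)) V) i.1 n.2 i.2.1 i.2.2.1) else 0) *
            (if n.1 = j.1 then (fun z : ℂ => if j.2.2.2 then z.im else z.re)
              ((latticeLangevinDynamics (fundamentalLatticeRep 2) β').noise
                (matrixConfig (fundamentalRep (Fin 2)) V) j.1 n.2 j.2.1 j.2.2.1) else 0)) := ⟨_, rfl⟩
  have hgenfc : Continuous genf := by rw [hgenf]; exact continuous_generator (L := L) β' (hf.of_le (by norm_num))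
  obtain ⟨Mg, hMg⟩ : ∃ M, ∀ V, |genf V| ≤ M := by
    obtain ⟨M, hM⟩ := isCompact_univ.exists_bound_of_continuousOn hgenfc.continuousOn
    exact ⟨M, fun V => by simpa [Real.norm_eq_abs] using hM V (Set.mem_univ V)⟩
  -- abbreviations: `PF τ x = κ_τ F (x)`, `PG τ x = κ_τ (𝓛F)(x)`, the mean `m₀`
  obtain ⟨PF, hPF⟩ : ∃ PF : ℝ → GaugeConfig 3 L (Matrix.specialUnitaryGroup (Fin 2) ℂ) → ℝ,
      PF = fun τ x => ∫ y, f (coords y) ∂(κ τ.toNNReal x) := ⟨_, rfl⟩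
  obtain ⟨PG, hPG⟩ : ∃ PG : ℝ → GaugeConfig 3 L (Matrix.specialUnitaryGroup (Fin 2) ℂ) → ℝ,
      PG = fun τ x => ∫ y, genf y ∂(κ τ.toNNReal x) := ⟨_, rfl⟩
  set m₀ : ℝ := ∫ z, f (coords z) ∂μ with hm₀
  have hPFb : ∀ τ x, |PF τ x| ≤ Mf := fun τ x => by
    rw [hPF]
    haveI : IsProbabilityMeasure (κ τ.toNNReal x) := IsMarkovKernel.isProbabilityMeasure x
    refine (abs_integral_le_integral_abs).trans ?_
    calc ∫ y, |f (coords y)| ∂(κ τ.toNNReal x) ≤ ∫ _y, Mf ∂(κ τ.toNNReal x) :=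
          integral_mono (integrable_of_continuous_of_compactSpace (continuous_abs.comp hFc) _)
            (integrable_const _) fun y => hMf y
      _ = Mf := by simp
  have hPGb : ∀ τ x, |PG τ x| ≤ Mg := fun τ x => by
    rw [hPG]
    haveI : IsProbabilityMeasure (κ τ.toNNReal x) := IsMarkovKernel.isProbabilityMeasure x
    refine (abs_integral_le_integral_abs).trans ?_
    calc ∫ y, |genf y| ∂(κ τ.toNNReal x) ≤ ∫ _y, Mg ∂(κ τ.toNNReal x) :=
          integral_mono (integrable_of_continuous_of_compactSpace (continuous_abs.comp hgenfc) _)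
            (integrable_const _) fun y => hMg y
      _ = Mg := by simp
  have hPFcx : ∀ τ, Continuous fun x => PF τ x := fun τ => by
    rw [hPF]; exact continuous_integral_transitionKernel L β' κ hreal τ.toNNReal hFc
  have hPGcx : ∀ τ, Continuous fun x => PG τ x := fun τ => by
    rw [hPG]; exact continuous_integral_transitionKernel L β' κ hreal τ.toNNReal hgenfc
  have hPFct : ∀ x, Continuous fun τ => PF τ x := fun x => by
    rw [hPF]
    exact (continuous_transitionKernel_action (L := L) β' κ hreal hFc).comp
      (continuous_real_toNNReal.prodMk continuous_const)
  have hPGct : ∀ x, Continuous fun τ => PG τ x := fun x => by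
    rw [hPG]
    exact (continuous_transitionKernel_action (L := L) β' κ hreal hgenfc).comp
      (continuous_real_toNNReal.prodMk continuous_const)
  -- the time derivative `∂_τ κ_τ F(x) = κ_τ(𝓛F)(x)` for `τ > 0` (Dynkin in kernel form + FTC)
  have hPFder : ∀ x {τ : ℝ}, 0 < τ → HasDerivAt (fun τ => PF τ x) (PG τ x) τ := fun x τ hτ => by
    have hDf := fun {σ : ℝ} (hσ : (0 : ℝ) ≤ σ) => transitionKernel_dynkin (L := L) β' κ hreal hf hfc x hσ
    have ha : Continuous fun r : ℝ => PG r x := hPGct x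
    have hder : HasDerivAt (fun σ : ℝ => f (coords x) + ∫ r in (0 : ℝ)..σ, PG r x) (PG τ x) τ :=
      ((intervalIntegral.integral_hasDerivAt_right (ha.intervalIntegrable _ _)
        (ha.stronglyMeasurableAtFilter _ _) ha.continuousAt)).const_add _
    refine hder.congr_of_eventuallyEq ?_
    filter_upwards [Ioi_mem_nhds hτ] with σ hσ
    have e := hDf (le_of_lt hσ)
    rw [hPF, hPG, hgenf]
    exact e
  -- invariance of `μ_{β'}`: `∫ κ_τ F dμ = m₀`
  have hinv : ∀ τ, ∫ x, PF τ x ∂μ = m₀ := fun τ => by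
    rw [hPF, hm₀]
    exact integral_transitionKernel_integral_eq_wilson (L := L) β' κ hreal τ.toNNReal hFc.measurable ⟨Mf, hMf⟩
  -- the variance `w(τ) = ∫ (κ_τF − m₀)² dμ`
  obtain ⟨w, hw⟩ : ∃ w : ℝ → ℝ, w = fun τ => ∫ x, (PF τ x - m₀) * (PF τ x - m₀) ∂μ := ⟨_, rfl⟩
  have hB : ∀ τ x, |PF τ x - m₀| ≤ Mf + |m₀| := fun τ x =>
    (abs_sub _ _).trans (by linarith [hPFb τ x])
  have hwc : Continuous w := by
    rw [hw]
    refine continuous_of_dominated (bound := fun _ => (Mf + |m₀|) * (Mf + |m₀|)) (fun τ => ?_) (fun τ => ?_)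
      (integrable_const _) (ae_of_all _ fun x => ?_)
    · exact (((hPFcx τ).sub continuous_const).mul ((hPFcx τ).sub continuous_const)).aestronglyMeasurable
    · refine ae_of_all _ fun x => ?_
      rw [Real.norm_eq_abs, abs_mul]
      exact mul_le_mul (hB τ x) (hB τ x) (abs_nonneg _) ((abs_nonneg _).trans (hB τ x))
    · exact ((hPFct x).sub continuous_const).mul ((hPFct x).sub continuous_const)
  -- its derivative on `(0, ∞)`
  have hwder : ∀ τ, 0 < τ → HasDerivAt w (∫ x, (PG τ x * (PF τ x - m₀) + (PF τ x - m₀) * PG τ x) ∂μ) τ := by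
    intro τ hτ
    rw [hw]
    have hs : Ioi (τ / 2) ∈ 𝓝 τ := Ioi_mem_nhds (by linarith)
    refine (hasDerivAt_integral_of_dominated_loc_of_deriv_le (μ := μ) (x₀ := τ)
      (F := fun σ x => (PF σ x - m₀) * (PF σ x - m₀))
      (F' := fun σ x => PG σ x * (PF σ x - m₀) + (PF σ x - m₀) * PG σ x)
      (bound := fun _ => 2 * (Mg * (Mf + |m₀|))) hs ?_ ?_ ?_ ?_ (integrable_const _) ?_).2
    · exact Filter.Eventually.of_forall fun σ =>
        (((hPFcx σ).sub continuous_const).mul ((hPFcx σ).sub continuous_const)).aestronglyMeasurable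
    · exact integrable_of_continuous_of_compactSpace
        (((hPFcx τ).sub continuous_const).mul ((hPFcx τ).sub continuous_const)) _
    · exact (((hPGcx τ).mul ((hPFcx τ).sub continuous_const)).add
        (((hPFcx τ).sub continuous_const).mul (hPGcx τ))).aestronglyMeasurable
    · refine ae_of_all _ fun x σ _ => ?_
      rw [Real.norm_eq_abs]
      refine (abs_add_le _ _).trans ?_
      rw [abs_mul, abs_mul, two_mul]
      exact add_le_add (mul_le_mul (hPGb σ x) (hB σ x) (abs_nonneg _) ((abs_nonneg _).trans (hPGb σ x)))
        (by rw [mul_comm]; exact mul_le_mul (hPGb σ x) (hB σ x) (abs_nonneg _) ((abs_nonneg _).trans (hPGb σ x)))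
    · refine ae_of_all _ fun x σ hσ => ?_
      have hσ0 : 0 < σ := lt_trans (by linarith) hσ
      exact ((hPFder x hσ0).sub_const m₀).mul ((hPFder x hσ0).sub_const m₀)
  -- the differential inequality `w' ≤ −2λ w` from the Poincaré hypothesis applied to `g_τ`
  have hineq : ∀ τ, 0 < τ → ∫ x, (PG τ x * (PF τ x - m₀) + (PF τ x - m₀) * PG τ x) ∂μ ≤ -(2 * lam) * w τ := by
    intro τ hτ
    set s : ℝ≥0 := τ.toNNReal with hs
    -- `κ_τ F = g_s ∘ coords`, `∫ g_s∘coords dμ = m₀`, `κ_τ(𝓛F) = 𝓛(g_s∘coords)`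
    have hPFg : ∀ x, PF τ x = g s (coords x) := fun x => by rw [hPF]; exact hgF s x
    have hmean : ∫ V', g s (coords V') ∂μ = m₀ := by
      rw [← hinv τ]; exact integral_congr_ae (ae_of_all _ fun x => (hPFg x).symm)
    have hP := hPgen (g s) (hg s)
    dsimp only at hP
    rw [hmean] at hP
    have hPGg : ∀ x, PG τ x = (∑ i : Edge 3 L × Fin 2 × Fin 2 × Bool, fderiv ℝ (g s) (coords x) (Pi.single i 1) *
          (fun z : ℂ => if i.2.2.2 then z.im else z.re)
            ((latticeLangevinDynamics (fundamentalLatticeRep 2) β').drift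
              (matrixConfig (fundamentalRep (Fin 2)) x) i.1 i.2.1 i.2.2.1) +
      1 / 2 * ∑ i : Edge 3 L × Fin 2 × Fin 2 × Bool, ∑ j : Edge 3 L × Fin 2 × Fin 2 × Bool,
        fderiv ℝ (fun z => fderiv ℝ (g s) z (Pi.single i 1)) (coords x) (Pi.single j 1) *
          ∑ n : Edge 3 L × NoiseIdx 2,
            (if n.1 = i.1 then (fun z : ℂ => if i.2.2.2 then z.im else z.re)
              ((latticeLangevinDynamics (fundamentalLatticeRep 2) β').noise
                (matrixConfig (fundamentalRep (Fin 2)) x) i.1 n.2 i.2.1 i.2.2.1) else 0) *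
            (if n.1 = j.1 then (fun z : ℂ => if j.2.2.2 then z.im else z.re)
              ((latticeLangevinDynamics (fundamentalLatticeRep 2) β').noise
                (matrixConfig (fundamentalRep (Fin 2)) x) j.1 n.2 j.2.1 j.2.2.1) else 0)) := fun x => by
      rw [hPG, hgenf]
      show ∫ y, _ ∂(κ τ.toNNReal x) = _
      rw [← hs]
      exact (hcomm s x).symm
    have hlhs : ∫ x, (PG τ x * (PF τ x - m₀) + (PF τ x - m₀) * PG τ x) ∂μ =
        2 * ∫ x, (g s (coords x) - m₀) * PG τ x ∂μ := by
      rw [← integral_const_mul]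
      refine integral_congr_ae (ae_of_all _ fun x => ?_)
      show PG τ x * (PF τ x - m₀) + (PF τ x - m₀) * PG τ x = 2 * ((g s (coords x) - m₀) * PG τ x)
      rw [hPFg x]; ring
    have hwτ : w τ = ∫ x, (g s (coords x) - m₀) ^ 2 ∂μ := by
      rw [hw]
      refine integral_congr_ae (ae_of_all _ fun x => ?_)
      simp only [hPFg x, sq]
    rw [hlhs, hwτ]
    have hP' : lam * ∫ V, (g s (coords V) - m₀) ^ 2 ∂μ ≤ -∫ V, (g s (coords V) - m₀) * PG τ V ∂μ := by
      refine Eq.trans_le rfl (hP.trans_eq ?_)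
      congr 1
      refine integral_congr_ae (ae_of_all _ fun V => ?_)
      show _ = (g s (coords V) - m₀) * PG τ V
      rw [hPGg V]
    linarith
  -- Grönwall
  have hgron := le_exp_mul_of_hasDerivAt_le (c := 2 * lam) hwc.continuousOn hwder hineq t.coe_nonneg
  -- `w 0 = Var(F)` (`κ_0 = id`) and `w t` is the left-hand side
  have hκ0 : κ 0 = Kernel.id := transitionKernel_zero_eq_id (L := L) (β' := β') κ hreal
  have hw0 : w 0 = ∫ x, (f (coords x) - m₀) ^ 2 ∂μ := by
    rw [hw]
    refine integral_congr_ae (ae_of_all _ fun x => ?_)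
    have h0 : PF 0 x = f (coords x) := by
      rw [hPF]
      show ∫ y, f (coords y) ∂(κ (0 : ℝ).toNNReal x) = f (coords x)
      rw [Real.toNNReal_zero, hκ0, Kernel.id_apply, integral_dirac' _ _ hFc.measurable.stronglyMeasurable]
    simp only [h0, sq]
  have hwt : w t = ∫ x, (PF t x - m₀) ^ 2 ∂μ := by
    rw [hw]; refine integral_congr_ae (ae_of_all _ fun x => ?_); simp only [sq]
  have hPFt : ∀ x, PF t x = ∫ y, f (coords y) ∂(κ t x) := fun x => by rw [hPF]; simp only [Real.toNNReal_coe]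
  simp only [hPFt] at hwt
  rw [← hwt, ← hw0, show -2 * lam * (t : ℝ) = -(2 * lam) * t by ring]
  exact hgron

end Summit.QuantumFields.YangMills.Theorems.ColdStartUniversality

end
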